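/-
Origin: expansion seat `literature-prover-pub-hodgecm-cf-hasseminkowski-g5-0`, handover #4 2026-08-18T06:18:04Z (`HOME/pub-hodgecm-cf-hasseminkowski-g5/handover/HodgeCM/Literature/ClassBaseChangeInjective.lean`, md5 6d64e291, 120 lines);
landed by the gen-6 packager in gate run 24 as `HodgeCM/Literature/ClassBaseChangeInjective.lean` (verbatim).
-/
/-
Origin: CITED-FACT seat (4), unit `pub-hodgecm-cf-hasseminkowski-g5` (session literature-prover-pub-hodgecm-cf-hasseminkowski-g5-0),
HodgeCM publication cell, 2026-08-18.  Intended landing: `HodgeCM/Literature/ClassBaseChangeInjective.lean` (after `ClassBaseChangePolar.lean` and the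
vendored `HodgeCM/Vendored/H21/NumberTheory/Automorphic/{GaloisActionPlaces, GaloisActionAdeleRing, ClassFieldCharacter}.lean`).
-/
import Summits.HodgeConjecture.HodgeCM.Literature.ClassBaseChangePolar
import Literature.NumberTheory.Automorphic.ClassFieldCharacter

/-!
# `C_K → C_L` is injective for `L/K` Galois ("injects", PerL l. 310) — and N15 without `hker`

PerL v5 §3.2, tex l. 310: "the image of the idele class group of `L₀`, which **injects** continuously and properly".
`ClassBaseChange.lean` proved "continuously and properly"; here: **`classBaseChange_injective`** for `L/K` Galois
(in particular quadratic, PerL's `L/L₀`), i.e. `𝕀_K ∩ L^× = K^×` inside `𝕀_L` — Galois descent: if `x_L = (ℓ)` then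
`(σ ℓ) = σ • (ℓ) = σ • x_L = x_L = (ℓ)` for every `σ ∈ Gal(L/K)` (the vendored tree lemmas `AdeleRing.smul_ideleBaseChange`,
`AdeleRing.smul_algebraMap` of `ClassFieldCharacter` / `GaloisActionAdeleRing`, Cassels–Fröhlich VII §1.1), so `ℓ` is
`Gal(L/K)`-fixed, hence in `K` (Mathlib `IsGalois.mem_bot_iff_fixed`), and `x = (ℓ)` already in `𝕀_K` (`ideleBaseChange_injective`).
Consequences: `isClosedEmbedding_classBaseChange` (pv10's `isClosedEmbedding_baseChange` with all inputs supplied) and the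
capstone corollaries **`exists_unitaryHeckeCharacter_of_classBaseChange'`** / **`exists_unitaryHeckeCharacter_of_isCMField'`**
in which pv10's hypothesis `hker` is GONE (it follows from injectivity): the N15 statement over the actual base change takes
only `χA`, its continuity, the infinity type `e` and the parity compatibility `hcompat`.

No PerL/QW8/2001 statement is used; no named fact is introduced; everything below is proved.
-/

set_option autoImplicit false

noncomputable section

open NumberField InfinitePlace

namespace NumberField

open Literature.NumberTheory Literature.NumberTheory.Automorphic

variable (K L : Type) [Field K] [NumberField K] [Field L] [NumberField L] [Algebra K L]

/-- **`𝕀_K ∩ L^× = K^×`** (Galois descent): a base-changed idele which is principal in `L` is principal in `K`. -/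
theorem ClassBaseChange.mem_principalIdeles_of_ideleBaseChange_mem [IsGalois K L] {x : ideleGroup K}
    (hx : AdeleRing.ideleBaseChange K L x ∈ principalIdeles L) : x ∈ principalIdeles K := by
  obtain ⟨ℓ, hℓ⟩ := hx
  -- `ℓ` is fixed by `Gal(L/K)`
  have hfix : ∀ σ : L ≃ₐ[K] L, σ (ℓ : L) = ℓ := by
    intro σ
    have h1 : ((σ • (Units.map (algebraMap L (AdeleRing (𝓞 L) L) : L →* AdeleRing (𝓞 L) L) ℓ) :
        (AdeleRing (𝓞 L) L)ˣ) : AdeleRing (𝓞 L) L) =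
        ((Units.map (algebraMap L (AdeleRing (𝓞 L) L) : L →* AdeleRing (𝓞 L) L) ℓ : (AdeleRing (𝓞 L) L)ˣ) :
          AdeleRing (𝓞 L) L) := by
      rw [hℓ, AdeleRing.smul_ideleBaseChange]
    rw [AdeleRing.coe_smul_units, Units.coe_map, MonoidHom.coe_coe, AdeleRing.smul_algebraMap] at h1
    exact NumberField.AdeleRing.algebraMap_injective (K := L) (R := 𝓞 L) h1
  -- hence `ℓ ∈ K`
  have hmem : (ℓ : L) ∈ (⊥ : IntermediateField K L) := (IsGalois.mem_bot_iff_fixed (ℓ : L)).mpr hfix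
  obtain ⟨k, hk⟩ := IntermediateField.mem_bot.mp hmem
  have hk0 : k ≠ 0 := by
    rintro rfl
    exact ℓ.ne_zero (by rw [← hk, map_zero])
  refine ⟨Units.mk0 k hk0, AdeleRing.ideleBaseChange_injective K L (Units.ext ?_)⟩
  rw [AdeleRing.coe_ideleBaseChange, Units.coe_map, MonoidHom.coe_coe, Units.val_mk0,
    AdeleRing.baseChange_algebraMap, hk, ← hℓ, Units.coe_map, MonoidHom.coe_coe]

/-- **`ι : C_K → C_L` is injective** for `L/K` Galois (PerL l. 310 "injects"). -/
theorem classBaseChange_injective [IsGalois K L] : Function.Injective (classBaseChange K L) := by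
  refine (injective_iff_map_eq_one (classBaseChange K L)).mpr fun c hc => ?_
  induction c using QuotientGroup.induction_on with
  | H x =>
    rw [classBaseChange_mk, QuotientGroup.eq_one_iff] at hc
    exact (QuotientGroup.eq_one_iff x).mpr (ClassBaseChange.mem_principalIdeles_of_ideleBaseChange_mem K L hc)

/-- `ι` is a closed embedding ("injects continuously and properly"): pv10's `isClosedEmbedding_baseChange` with every
input supplied. -/
theorem isClosedEmbedding_classBaseChange [IsGalois K L] : Topology.IsClosedEmbedding (classBaseChange K L) :=
  isClosedEmbedding_baseChange K L (normOneIdeleClassesCompact_holds K) (continuous_classBaseChange K L)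
    (classBaseChange_injective K L) (finrank_div_finrank_ne_zero K L) (logClassNorm_classBaseChange K L)

/-- pv10's hypothesis `hker` is automatic for an injective `f`. -/
theorem ClassBaseChange.hker_of_injective [IsGalois K L] (χA : IdeleClassGroup K →* Circle) (a : IdeleClassGroup K)
    (ha : classBaseChange K L a = 1) : χA a = 1 := by
  rw [(classBaseChange_injective K L) (ha.trans (map_one (classBaseChange K L)).symm), map_one]

/-- **N15 over the actual base change, `L/K` Galois with unique places above the infinite places of `K`** — the
capstone with `f`, `hf`, `hker`, `hpolar` all supplied; inputs: `χA`, `hχA`, `e`, `hcompat`. -/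
theorem exists_unitaryHeckeCharacter_of_classBaseChange' [IsGalois K L]
    (hinj : Function.Injective fun w : InfinitePlace L => w.comap (algebraMap K L))
    (χA : IdeleClassGroup K →* Circle) (hχA : Continuous χA) (e : InfinitePlace L → ℤ)
    (hcompat : ∀ (a : IdeleClassGroup K) (u : (InfiniteAdeleRing L)ˣ),
      classBaseChange K L a = infUnitsToClass L u → χA a = infinityTypeChar L e u) :
    ∃ ψ : UnitaryHeckeCharacter L, ψ.HasInfinityType L e ∧ ∀ a, ψ (classBaseChange K L a) = χA a :=
  exists_unitaryHeckeCharacter_of_classBaseChange K L hinj χA hχA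
    (ClassBaseChange.hker_of_injective K L χA) e hcompat

/-! ### The CM case -/

section CM

variable (L : Type) [Field L] [NumberField L] [IsCMField L]

/-- `C_{L⁺} → C_L` is a closed embedding for a CM field `L`. -/
theorem isClosedEmbedding_classBaseChange_of_isCMField :
    Topology.IsClosedEmbedding (classBaseChange (maximalRealSubfield L) L) :=
  isClosedEmbedding_classBaseChange (maximalRealSubfield L) L

/-- **N15 for a CM field over its maximal real subfield, final form**: for every continuous character `χA` of
`C_{L⁺}` and every infinity type `e` compatible with `χA` on base-changed infinite classes there is a unitary Hecke
character `ψ` of `L` of infinity type `e` with `ψ ∘ ι = χA` (PerL v5 tex ll. 305–313, all structural steps KERNEL;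
PerL applies it with `χA = ε^m_{L/L₀}` and `e = (m_b)_b`, `m_b ≡ m (mod 2)`). -/
theorem exists_unitaryHeckeCharacter_of_isCMField'
    (χA : IdeleClassGroup (maximalRealSubfield L) →* Circle) (hχA : Continuous χA) (e : InfinitePlace L → ℤ)
    (hcompat : ∀ (a : IdeleClassGroup (maximalRealSubfield L)) (u : (InfiniteAdeleRing L)ˣ),
      classBaseChange (maximalRealSubfield L) L a = infUnitsToClass L u → χA a = infinityTypeChar L e u) :
    ∃ ψ : UnitaryHeckeCharacter L, ψ.HasInfinityType L e ∧
      ∀ a, ψ (classBaseChange (maximalRealSubfield L) L a) = χA a :=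
  exists_unitaryHeckeCharacter_of_classBaseChange' (maximalRealSubfield L) L (comap_injective_of_isCMField L)
    χA hχA e hcompat

end CM

end NumberField

end
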